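import Literature.NumberTheory.Automorphic.ConstituentPairFixedRank   -- ★ JH-PAIR-RANKS: labelled sub∕quotient pair, class invariance of `dim π^K`, of «`π^K = 0`»
import HarnessLib

/-!
# The Euler–Poincaré dichotomy for a length-two representation with levels `(1, 1, 2)`
# (Serre 1980 Trees II.1.4; Bernstein–Zelevinsky 1976 §2.3; Kottwitz 1988 §2; Borel 1976 §3–§4; Rogawski 1990 §12.2)

Topic `NumberTheory/Automorphic`.  PROOF FILE: theorems only (no definition, no instance, no notation, no named fact, no `sorry`).

SETTING.  `G` a topological group, `K₀ K₁ : Subgroup G` two subgroups that GENERATE `G` (`K₀ ⊔ K₁ = ⊤`; for a rank-one `p`-adic group: the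
stabilisers of the two ends of an edge of the Bruhat–Tits tree, [Serre1980Trees, II.1.4 Thm. 6]), `I := K₀ ⊓ K₁`.  For a representation `X`
with finite-dimensional level spaces write (INLINE — no definition is introduced)

  `ep X := dim X^{K₀} + dim X^{K₁} − dim X^{I} ∈ ℤ`,

the pairing of `X` with Kottwitz's Euler–Poincaré function `𝟙_{K₀}∕vol K₀ + 𝟙_{K₁}∕vol K₁ − 𝟙_I∕vol I` [Kottwitz1988, §2] when the `K`'s are compact
open in a locally profinite `G` and `X` is admissible (★ `SmoothCharacter.smoothTrace_indicator`).

RESULTS.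
* §1 `fixedPoints_sup` — `X^{K₀ ⊔ K₁} = X^{K₀} ⊓ X^{K₁}` (pure algebra); `finrank_fixedPoints_sup_eq_one` — if `dim X^{K₀} = dim X^{K₁} = dim X^{I} = 1`
  then the two lines coincide with `X^{I}` and `dim X^{K₀ ⊔ K₁} = 1`: **a `K₀`-fixed line and a `K₁`-fixed line inside a one-dimensional `I`-fixed
  space are the same line, hence `G`-fixed when `K₀ ⊔ K₁ = G`**; `fixedPoints_top_ne_bot_iff_forall` — for an IRREDUCIBLE `X`, «a non-zero
  `G`-fixed vector» ⟺ «`G` acts trivially».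
* §2 **`ep_dichotomy_of_subrepresentation`** — `ρ` SMOOTH with levels `dim ρ^{K₀} = dim ρ^{K₁} = 1`, `dim ρ^{I} = 2` (`K₀`, `K₁` compact,
  `K₀ ⊔ K₁ = ⊤`), `N` ANY subrepresentation: **either `ep(ρ|_N) = 0 ∧ ep(ρ⁄N) = 0`, or `ρ|_N` or `ρ⁄N` has a non-zero `G`-fixed vector.**
  Proof = ★ RANK-ADD `finrank_fixedPoints_eq_add_of_subrepresentation` on the three levels (`(a,b,c) + (a',b',c') = (1,1,2)`, `a, b ≤ c`,
  `a', b' ≤ c'`) — the only splittings with `ep ≠ 0` are `(1,1,1) + (0,0,1)` and its mirror, and `(1,1,1)` is §1's coincidence.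
* §3 **`ep_eq_zero_of_constituents_pair`** — class level, over ★ JH-PAIR-RANKS: `ρ` smooth without `3`-chains of subrepresentations, constituents
  EXACTLY `a ≠ b` (the shape in which the tree pins the reducible principal series of [Rogawski1990, §12.2]), levels `(1,1,2)`, and NEITHER `a`
  NOR `b` the class of a representation on which `G` acts trivially ⇒ `ep a = ep b = 0` for any representatives.  The excluded branch is the
  `{𝟙_G, St_G}` pattern of `i_G(δ^{-1∕2})` (`ep = +1, −1`).

* §4 (ED. 2) **`ep_eq_zero_of_isConstituentOf_of_reducible`**, **`finrank_fixedPoints_eq_zero_of_isConstituentOf_of_reducible`** — the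
  LABEL-FREE class level: `ρ` smooth without `3`-chains, SOME proper subrepresentation `⊥ ≠ N ≠ ⊤` (reducible), and NO constituent on which `G`
  acts trivially ⇒ `ep r = 0` for EVERY constituent `r` (levels `(1,1,2)`), resp. `dim r^K = 0` whenever `dim ρ^K = 0` (`K` compact) — §2 at `N`,
  whose two pieces are irreducible and exhaust the constituents (★ `isConstituentOf_iff_of_isIrreducible`); no `a ≠ b` is needed, so the
  l.d.s. pairs of [Rogawski1990, §12.2 (3)] are covered in the shape the tree pins them (`∃ N, N ≠ ⊥ ∧ N ≠ ⊤`).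

USE (E1 residue matrix, `h61bRest` (i) cells; [Rogawski1990, §12.2, §12.6]).  For the unramified `U(3)` and an unramified principal series `i_G(χ)`
(levels `(1,1,2)` by Iwasawa at BOTH vertex types + Bruhat–Iwahori, ★ `UnitaryBruhatIwahoriThree` with ★ MACKEY) of length two with constituents
`{π²(ξ), πⁿ(ξ)}` or an l.d.s. pair: `ep(π²(ξ)) = ep(πⁿ(ξ)) = 0` — WITHOUT deciding which constituent carries the `K₁`-spherical line (no
`c`-function of the non-hyperspecial vertex is needed).  Generation `K₀ ⊔ K₁ = ⊤` for the lattice levels of `U(Φ₃)` is the model brick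
«LEVELS GENERATE» (separate file).

HONEST LABEL: generic base layer, count-neutral; HC_CM is proved only modulo the 7 printed citations (2 remaining: hLiu418 =
stmt-HodgeConjecture-24832, h413 = stmt-HodgeConjecture-24833) until rung 0 closes.
## References
* [Serre1980Trees] J.-P. Serre, *Trees*, Springer (1980), Ch. I §4.1 Thm. 6, Ch. II §1.4 (amalgams ∕ `SL₂`, `G = ⟨G_P, G_Q⟩` for an edge `PQ`).
* [BernsteinZelevinsky1976] I. N. Bernstein, A. V. Zelevinsky, *Representations of the group GL(n,F) where F is a non-archimedean local field*,
  Russian Math. Surveys 31:3 (1976), §2.3 (exactness of `V ↦ V^K`).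
* [Kottwitz1988] R. Kottwitz, *Tamagawa numbers*, Ann. of Math. 127 (1988), §2 (Euler–Poincaré functions).
* [Borel1976] A. Borel, *Admissible representations of a semi-simple group over a local field with vectors fixed under an Iwahori subgroup*,
  Invent. Math. 35 (1976), §3–§4.
* [Rogawski1990] J. D. Rogawski, *Automorphic Representations of Unitary Groups in Three Variables*, Ann. of Math. Stud. 123 (1990), §12.2
  pp. 172–174, §12.6 pp. 187–189.
-/

set_option autoImplicit false

noncomputable section

namespace Literature.NumberTheory.Automorphic

universe u

/-! ## §1 Pure algebra: `X^{K₀ ⊔ K₁} = X^{K₀} ⊓ X^{K₁}`, coincidence of two lines in a one-dimensional `I`-level, irreducible + fixed vector -/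

section Algebra

variable {k G V : Type*} [Field k] [Group G] [AddCommGroup V] [Module k V] (ρ : Representation k G V)

/-- `X^{K₀ ⊔ K₁} = X^{K₀} ⊓ X^{K₁}`: a vector is fixed by the subgroup generated by `K₀` and `K₁` iff it is fixed by both (its stabiliser is a subgroup).
[cite: Serre1980Trees, Ch. I §4.1 Thm. 6] -/
theorem fixedPoints_sup (K₀ K₁ : Subgroup G) : ρ.fixedPoints (K₀ ⊔ K₁) = ρ.fixedPoints K₀ ⊓ ρ.fixedPoints K₁ := by
  ext v
  simp only [Submodule.mem_inf, Representation.mem_fixedPoints_iff_le_stabilizerSubgroup, sup_le_iff]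

/-- `v ∈ X^{⊤} ↔ ∀ g, ρ g v = v`. [cite: BernsteinZelevinsky1976, §2.3] -/
theorem mem_fixedPoints_top_iff (v : V) : v ∈ ρ.fixedPoints (⊤ : Subgroup G) ↔ ∀ g : G, ρ g v = v := by
  simp only [Representation.mem_fixedPoints, Subgroup.mem_top, forall_const]

/-- **COINCIDENCE OF LINES.** If `dim X^{K₀} = dim X^{K₁} = dim X^{K₀ ⊓ K₁} = 1` then `X^{K₀} = X^{K₀ ⊓ K₁} = X^{K₁}` (two lines inside the same line),
so `X^{K₀ ⊔ K₁} = X^{K₀ ⊓ K₁}` is one-dimensional: a vector fixed by `K₀` and one fixed by `K₁` are proportional and BOTH are fixed by `K₀ ⊔ K₁`.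
[cite: Serre1980Trees, Ch. II §1.4] [cite: Borel1976, §3–§4] -/
theorem fixedPoints_sup_eq_inf_of_finrank_eq_one {K₀ K₁ : Subgroup G} (h₀ : Module.finrank k (ρ.fixedPoints K₀) = 1)
    (h₁ : Module.finrank k (ρ.fixedPoints K₁) = 1) (hI : Module.finrank k (ρ.fixedPoints (K₀ ⊓ K₁)) = 1) :
    ρ.fixedPoints (K₀ ⊔ K₁) = ρ.fixedPoints (K₀ ⊓ K₁) := by
  haveI : FiniteDimensional k (ρ.fixedPoints (K₀ ⊓ K₁)) := .of_finrank_eq_succ hI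
  have e₀ : ρ.fixedPoints K₀ = ρ.fixedPoints (K₀ ⊓ K₁) :=
    Submodule.eq_of_le_of_finrank_eq (ρ.fixedPoints_antitone inf_le_left) (h₀.trans hI.symm)
  have e₁ : ρ.fixedPoints K₁ = ρ.fixedPoints (K₀ ⊓ K₁) :=
    Submodule.eq_of_le_of_finrank_eq (ρ.fixedPoints_antitone inf_le_right) (h₁.trans hI.symm)
  rw [fixedPoints_sup, e₀, e₁, inf_idem]

/-- `dim X^{K₀} = dim X^{K₁} = dim X^{K₀ ⊓ K₁} = 1 ⇒ dim X^{K₀ ⊔ K₁} = 1`. [cite: Serre1980Trees, Ch. II §1.4] [cite: Borel1976, §3–§4] -/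
theorem finrank_fixedPoints_sup_eq_one {K₀ K₁ : Subgroup G} (h₀ : Module.finrank k (ρ.fixedPoints K₀) = 1)
    (h₁ : Module.finrank k (ρ.fixedPoints K₁) = 1) (hI : Module.finrank k (ρ.fixedPoints (K₀ ⊓ K₁)) = 1) :
    Module.finrank k (ρ.fixedPoints (K₀ ⊔ K₁)) = 1 := by
  rw [fixedPoints_sup_eq_inf_of_finrank_eq_one ρ h₀ h₁ hI, hI]

/-- With `K₀ ⊔ K₁ = ⊤`: levels `(1,1,1)` force a NON-ZERO `G`-FIXED VECTOR. [cite: Serre1980Trees, Ch. II §1.4 Thm. 6] [cite: Borel1976, §3–§4] -/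
theorem fixedPoints_top_ne_bot_of_finrank_eq_one {K₀ K₁ : Subgroup G} (hgen : K₀ ⊔ K₁ = ⊤) (h₀ : Module.finrank k (ρ.fixedPoints K₀) = 1)
    (h₁ : Module.finrank k (ρ.fixedPoints K₁) = 1) (hI : Module.finrank k (ρ.fixedPoints (K₀ ⊓ K₁)) = 1) :
    ρ.fixedPoints (⊤ : Subgroup G) ≠ ⊥ := by
  have h := finrank_fixedPoints_sup_eq_one ρ h₀ h₁ hI
  rw [hgen] at h
  intro hbot
  rw [hbot, finrank_bot] at h
  exact zero_ne_one h

/-- **IRREDUCIBLE + A NON-ZERO `G`-FIXED VECTOR ⟺ `G` ACTS TRIVIALLY**: the fixed vectors `X^{G}` form a subrepresentation, which is `⊥` or `⊤`.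
[cite: BernsteinZelevinsky1976, §2.3] -/
theorem fixedPoints_top_ne_bot_iff_forall [ρ.IsIrreducible] :
    ρ.fixedPoints (⊤ : Subgroup G) ≠ ⊥ ↔ ∀ (g : G) (v : V), ρ g v = v := by
  constructor
  · intro hne g v
    -- the `G`-fixed vectors form a subrepresentation `F`; irreducibility: `F = ⊥` (excluded) or `F = ⊤`
    let F : Subrepresentation ρ :=
      { toSubmodule := ρ.fixedPoints (⊤ : Subgroup G)
        apply_mem_toSubmodule := fun g' w hw => by
          rw [mem_fixedPoints_top_iff] at hw ⊢
          intro g''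
          rw [hw g', hw g''] }
    rcases IsSimpleOrder.eq_bot_or_eq_top F with hF | hF
    · exact absurd (congrArg Subrepresentation.toSubmodule hF) hne
    · have hv : v ∈ F.toSubmodule := by rw [hF]; trivial
      exact (mem_fixedPoints_top_iff ρ v).1 hv g
  · intro hall hbot
    -- an irreducible representation is non-zero
    obtain ⟨v, hv⟩ : ∃ v : V, v ≠ 0 := by
      by_contra h
      push Not at h
      haveI : Subsingleton V := ⟨fun a b => by rw [h a, h b]⟩
      have : (⊥ : Subrepresentation ρ) = ⊤ := Subrepresentation.toSubmodule_injective (Subsingleton.elim _ _)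
      exact IsSimpleOrder.bot_ne_top this
    have hmem : v ∈ ρ.fixedPoints (⊤ : Subgroup G) := (mem_fixedPoints_top_iff ρ v).2 fun g => hall g v
    rw [hbot, Submodule.mem_bot] at hmem
    exact hv hmem

end Algebra

/-! ## §2 The dichotomy along a subrepresentation -/

section Dichotomy

variable {k G V : Type*} [Field k] [CharZero k] [Group G] [TopologicalSpace G] [IsTopologicalGroup G]
  [AddCommGroup V] [Module k V] {ρ : Representation k G V}

omit [CharZero k] [TopologicalSpace G] [IsTopologicalGroup G] in
/-- The level spaces of a subrepresentation are finite-dimensional when those of `ρ` are (restriction of the injection `N ↪ V`).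
[cite: BernsteinZelevinsky1976, §2.3] -/
theorem finiteDimensional_fixedPoints_toRepresentation (N : Subrepresentation ρ) (K : Subgroup G) [FiniteDimensional k (ρ.fixedPoints K)] :
    FiniteDimensional k (N.toRepresentation.fixedPoints K) := by
  let iK : N.toRepresentation.fixedPoints K →ₗ[k] ρ.fixedPoints K :=
    { toFun := fun a => ⟨((a : N.toSubmodule) : V), Representation.coe_mem_fixedPoints_of_mem ρ N a.2⟩
      map_add' := fun a b => Subtype.ext rfl
      map_smul' := fun c a => Subtype.ext rfl }
  have hiK : Function.Injective iK := fun a b h =>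
    Subtype.ext (Subtype.ext (congrArg (fun x : ρ.fixedPoints K => (x : V)) h))
  exact Module.Finite.of_injective iK hiK

/-- The level spaces of a quotient of a SMOOTH `ρ` by a subrepresentation are finite-dimensional when those of `ρ` are (`(V⁄N)^K = q(V^K)` for
`K` compact, ★ `map_fixedPoints_eq_of_surjective`). [cite: BernsteinZelevinsky1976, §2.3] -/
theorem finiteDimensional_fixedPoints_quotientRep (hρ : ρ.IsSmooth) (N : Subrepresentation ρ) {K : Subgroup G} (hKc : IsCompact (K : Set G))
    [FiniteDimensional k (ρ.fixedPoints K)] : FiniteDimensional k (N.quotientRep.fixedPoints K) := by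
  rw [← Representation.map_fixedPoints_eq_of_surjective hρ N.mkQ N.mkQ_surjective hKc]
  infer_instance

/-- **THE EULER–POINCARÉ DICHOTOMY.**  `ρ` smooth, `K₀`, `K₁`, `K₀ ⊓ K₁` compact (the third follows from the first two in a Hausdorff group) with `K₀ ⊔ K₁ = ⊤`, levels `dim ρ^{K₀} = dim ρ^{K₁} = 1`, `dim ρ^{K₀ ⊓ K₁} = 2`;
`N` any subrepresentation.  Then EITHER `ep(ρ|_N) = 0` and `ep(ρ⁄N) = 0` (`ep X = dim X^{K₀} + dim X^{K₁} − dim X^{K₀ ⊓ K₁}`, written inline),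
OR `ρ|_N` has a non-zero `G`-fixed vector, OR `ρ⁄N` has one.  (Rank additivity ★ on the three levels: `(a,b,c) + (a',b',c') = (1,1,2)` with
`a,b ≤ c`, `a',b' ≤ c'`; `ep ≠ 0` only for `(1,1,1)+(0,0,1)` or its mirror, and `(1,1,1)` is §1's coincidence of lines.)
[cite: Kottwitz1988, §2] [cite: BernsteinZelevinsky1976, §2.3] [cite: Serre1980Trees, Ch. II §1.4 Thm. 6] [cite: Borel1976, §3–§4] -/
theorem ep_dichotomy_of_subrepresentation (hρ : ρ.IsSmooth) (N : Subrepresentation ρ) {K₀ K₁ : Subgroup G}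
    (hK₀c : IsCompact (K₀ : Set G)) (hK₁c : IsCompact (K₁ : Set G)) (hIc : IsCompact ((K₀ ⊓ K₁ : Subgroup G) : Set G))
    (hgen : K₀ ⊔ K₁ = ⊤)
    (h₀ : Module.finrank k (ρ.fixedPoints K₀) = 1) (h₁ : Module.finrank k (ρ.fixedPoints K₁) = 1)
    (hI : Module.finrank k (ρ.fixedPoints (K₀ ⊓ K₁)) = 2) :
    ((Module.finrank k (N.toRepresentation.fixedPoints K₀) : ℤ) + Module.finrank k (N.toRepresentation.fixedPoints K₁)
          - Module.finrank k (N.toRepresentation.fixedPoints (K₀ ⊓ K₁)) = 0 ∧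
      (Module.finrank k (N.quotientRep.fixedPoints K₀) : ℤ) + Module.finrank k (N.quotientRep.fixedPoints K₁)
          - Module.finrank k (N.quotientRep.fixedPoints (K₀ ⊓ K₁)) = 0) ∨
    N.toRepresentation.fixedPoints (⊤ : Subgroup G) ≠ ⊥ ∨ N.quotientRep.fixedPoints (⊤ : Subgroup G) ≠ ⊥ := by
  haveI : FiniteDimensional k (ρ.fixedPoints K₀) := .of_finrank_eq_succ h₀
  haveI : FiniteDimensional k (ρ.fixedPoints K₁) := .of_finrank_eq_succ h₁
  haveI : FiniteDimensional k (ρ.fixedPoints (K₀ ⊓ K₁)) := .of_finrank_eq_succ hI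
  haveI := finiteDimensional_fixedPoints_toRepresentation N (K₀ ⊓ K₁)
  haveI := finiteDimensional_fixedPoints_quotientRep hρ N hIc
  -- rank additivity on the three levels
  have hA₀ := Representation.finrank_fixedPoints_eq_add_of_subrepresentation ρ hρ N hK₀c
  have hA₁ := Representation.finrank_fixedPoints_eq_add_of_subrepresentation ρ hρ N hK₁c
  have hAI := Representation.finrank_fixedPoints_eq_add_of_subrepresentation ρ hρ N hIc
  rw [h₀] at hA₀; rw [h₁] at hA₁; rw [hI] at hAI
  -- monotonicity `X^{K_i} ≤ X^{K₀ ⊓ K₁}` inside `N` and inside `V⁄N`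
  have hN₀ : Module.finrank k (N.toRepresentation.fixedPoints K₀) ≤ Module.finrank k (N.toRepresentation.fixedPoints (K₀ ⊓ K₁)) :=
    Submodule.finrank_mono (N.toRepresentation.fixedPoints_antitone inf_le_left)
  have hN₁ : Module.finrank k (N.toRepresentation.fixedPoints K₁) ≤ Module.finrank k (N.toRepresentation.fixedPoints (K₀ ⊓ K₁)) :=
    Submodule.finrank_mono (N.toRepresentation.fixedPoints_antitone inf_le_right)
  have hQ₀ : Module.finrank k (N.quotientRep.fixedPoints K₀) ≤ Module.finrank k (N.quotientRep.fixedPoints (K₀ ⊓ K₁)) :=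
    Submodule.finrank_mono (N.quotientRep.fixedPoints_antitone inf_le_left)
  have hQ₁ : Module.finrank k (N.quotientRep.fixedPoints K₁) ≤ Module.finrank k (N.quotientRep.fixedPoints (K₀ ⊓ K₁)) :=
    Submodule.finrank_mono (N.quotientRep.fixedPoints_antitone inf_le_right)
  -- case analysis on `c = dim N^{K₀ ⊓ K₁} ∈ {0, 1, 2}`
  by_cases hz : (Module.finrank k (N.toRepresentation.fixedPoints K₀) : ℤ) + Module.finrank k (N.toRepresentation.fixedPoints K₁)
          - Module.finrank k (N.toRepresentation.fixedPoints (K₀ ⊓ K₁)) = 0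
  · left
    exact ⟨hz, by omega⟩
  · right
    -- `ep(N) ≠ 0` forces `dim N^{I} = 1` and then `(a, b) = (1, 1)` or `(0, 0)`
    have hc : Module.finrank k (N.toRepresentation.fixedPoints (K₀ ⊓ K₁)) = 1 := by omega
    by_cases ha : Module.finrank k (N.toRepresentation.fixedPoints K₀) = 1
    · have hb : Module.finrank k (N.toRepresentation.fixedPoints K₁) = 1 := by omega
      exact Or.inl (fixedPoints_top_ne_bot_of_finrank_eq_one N.toRepresentation hgen ha hb hc)
    · have ha' : Module.finrank k (N.quotientRep.fixedPoints K₀) = 1 := by omega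
      have hb' : Module.finrank k (N.quotientRep.fixedPoints K₁) = 1 := by omega
      have hc' : Module.finrank k (N.quotientRep.fixedPoints (K₀ ⊓ K₁)) = 1 := by omega
      exact Or.inr (fixedPoints_top_ne_bot_of_finrank_eq_one N.quotientRep hgen ha' hb' hc')

end Dichotomy

/-! ## §3 Class level: `ep a = ep b = 0` on a Jordan–Hölder pair of non-trivial classes -/

namespace IrrClass

variable {G : Type u} [Group G] [TopologicalSpace G] [IsTopologicalGroup G]

/-- **`ep a = ep b = 0` FOR THE TWO CONSTITUENTS OF A LENGTH-TWO REPRESENTATION WITH LEVELS `(1,1,2)`**, provided neither `a` nor `b` is the class of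
a representation on which `G` acts trivially: `ρ` smooth without `3`-chains of subrepresentations, constituents exactly `a ≠ b` (★
`exists_subrepresentation_labels_of_constituents_pair`), `K₀`, `K₁` compact with `K₀ ⊔ K₁ = ⊤`, `r`, `r'` ANY representatives of `a`, `b`
(★ class invariance of the levels).  Reading [Rogawski1990, §12.2]: for an unramified principal series of the unramified `U(3)` with constituents
`{π²(ξ), πⁿ(ξ)}` — or an l.d.s. pair — `Tr π(f_EP) = 0` for both constituents; the excluded branch is `{𝟙_G, St_G}`.
[cite: Kottwitz1988, §2] [cite: Borel1976, §3–§4] [cite: Rogawski1990, §12.2 pp. 173–174] [cite: BernsteinZelevinsky1976, §2.3] -/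
theorem ep_eq_zero_of_constituents_pair {V : Type} [AddCommGroup V] [Module ℂ V] {ρ : Representation ℂ G V}
    (hρ : ρ.IsSmooth) (hlen : ∀ N₁ N₂ : Subrepresentation ρ, ¬ (⊥ < N₁ ∧ N₁ < N₂ ∧ N₂ < ⊤))
    {a b : IrrClass G} (hJH : ∀ c : IrrClass G, c.IsConstituentOf ρ ↔ (c = a ∨ c = b)) (hab : a ≠ b)
    {r r' : SmoothIrrep G} (hr : IrrClass.mk r = a) (hr' : IrrClass.mk r' = b)
    (ha : ∃ (g : G) (v : r.V), r.ρ g v ≠ v) (hb : ∃ (g : G) (v : r'.V), r'.ρ g v ≠ v)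
    {K₀ K₁ : Subgroup G} (hK₀c : IsCompact (K₀ : Set G)) (hK₁c : IsCompact (K₁ : Set G))
    (hIc : IsCompact ((K₀ ⊓ K₁ : Subgroup G) : Set G)) (hgen : K₀ ⊔ K₁ = ⊤)
    (h₀ : Module.finrank ℂ (ρ.fixedPoints K₀) = 1) (h₁ : Module.finrank ℂ (ρ.fixedPoints K₁) = 1)
    (hI : Module.finrank ℂ (ρ.fixedPoints (K₀ ⊓ K₁)) = 2) :
    ((Module.finrank ℂ (r.ρ.fixedPoints K₀) : ℤ) + Module.finrank ℂ (r.ρ.fixedPoints K₁) - Module.finrank ℂ (r.ρ.fixedPoints (K₀ ⊓ K₁)) = 0) ∧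
    ((Module.finrank ℂ (r'.ρ.fixedPoints K₀) : ℤ) + Module.finrank ℂ (r'.ρ.fixedPoints K₁) - Module.finrank ℂ (r'.ρ.fixedPoints (K₀ ⊓ K₁)) = 0) := by
  obtain ⟨N, hN, hQ, hlab⟩ := exists_subrepresentation_labels_of_constituents_pair hρ hlen hJH hab
  have hdich := ep_dichotomy_of_subrepresentation hρ N hK₀c hK₁c hIc hgen h₀ h₁ hI
  -- the representatives have no non-zero `G`-fixed vector (§1's irreducible criterion)
  have hra : r.ρ.fixedPoints (⊤ : Subgroup G) = ⊥ := by
    by_contra h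
    obtain ⟨g, v, hgv⟩ := ha
    exact hgv ((fixedPoints_top_ne_bot_iff_forall r.ρ).1 h g v)
  have hrb : r'.ρ.fixedPoints (⊤ : Subgroup G) = ⊥ := by
    by_contra h
    obtain ⟨g, v, hgv⟩ := hb
    exact hgv ((fixedPoints_top_ne_bot_iff_forall r'.ρ).1 h g v)
  rcases hlab with ⟨hNa, hQb⟩ | ⟨hNb, hQa⟩
  · have eN := hr.trans hNa.symm
    have eQ := hr'.trans hQb.symm
    -- class invariance of «`X^G = 0`» transports `hra`, `hrb` to `N`, `V⁄N`
    have hNbot : N.toRepresentation.fixedPoints (⊤ : Subgroup G) = ⊥ := (fixedPoints_eq_bot_iff_of_mk_eq_mk eN ⊤).1 hra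
    have hQbot : N.quotientRep.fixedPoints (⊤ : Subgroup G) = ⊥ := (fixedPoints_eq_bot_iff_of_mk_eq_mk eQ ⊤).1 hrb
    rcases hdich with ⟨hN0, hQ0⟩ | h | h
    · rw [finrank_fixedPoints_eq_of_mk_eq_mk eN K₀, finrank_fixedPoints_eq_of_mk_eq_mk eN K₁, finrank_fixedPoints_eq_of_mk_eq_mk eN (K₀ ⊓ K₁),
        finrank_fixedPoints_eq_of_mk_eq_mk eQ K₀, finrank_fixedPoints_eq_of_mk_eq_mk eQ K₁, finrank_fixedPoints_eq_of_mk_eq_mk eQ (K₀ ⊓ K₁)]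
      exact ⟨hN0, hQ0⟩
    · exact absurd hNbot h
    · exact absurd hQbot h
  · have eQ := hr.trans hQa.symm
    have eN := hr'.trans hNb.symm
    have hNbot : N.toRepresentation.fixedPoints (⊤ : Subgroup G) = ⊥ := (fixedPoints_eq_bot_iff_of_mk_eq_mk eN ⊤).1 hrb
    have hQbot : N.quotientRep.fixedPoints (⊤ : Subgroup G) = ⊥ := (fixedPoints_eq_bot_iff_of_mk_eq_mk eQ ⊤).1 hra
    rcases hdich with ⟨hN0, hQ0⟩ | h | h
    · rw [finrank_fixedPoints_eq_of_mk_eq_mk eQ K₀, finrank_fixedPoints_eq_of_mk_eq_mk eQ K₁, finrank_fixedPoints_eq_of_mk_eq_mk eQ (K₀ ⊓ K₁),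
        finrank_fixedPoints_eq_of_mk_eq_mk eN K₀, finrank_fixedPoints_eq_of_mk_eq_mk eN K₁, finrank_fixedPoints_eq_of_mk_eq_mk eN (K₀ ⊓ K₁)]
      exact ⟨hQ0, hN0⟩
    · exact absurd hNbot h
    · exact absurd hQbot h

end IrrClass

/-! ## §4 (ED. 2) Class level without labels: every constituent of a reducible `ρ` without `3`-chains and without trivial-action constituents -/

namespace IrrClass

variable {G : Type u} [Group G] [TopologicalSpace G] [IsTopologicalGroup G]

/-- **`dim r^K = 0` FOR EVERY CONSTITUENT `r` WHEN `dim ρ^K = 0`** (`ρ` smooth without `3`-chains, reducible: some `⊥ ≠ N ≠ ⊤`; `K` compact):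
★ RANK-ADD `dim ρ^K = dim N^K + dim (ρ⁄N)^K` at such an `N`, whose pieces `ρ|_N`, `ρ⁄N` are irreducible and exhaust the constituents
(★ `isConstituentOf_iff_of_isIrreducible`), then ★ class invariance of `dim π^K`. [cite: BernsteinZelevinsky1976, §2.3]
[cite: Rogawski1990, §12.2 pp. 173–174] -/
theorem finrank_fixedPoints_eq_zero_of_isConstituentOf_of_reducible {V : Type} [AddCommGroup V] [Module ℂ V] {ρ : Representation ℂ G V}
    (hρ : ρ.IsSmooth) (hlen : ∀ N₁ N₂ : Subrepresentation ρ, ¬ (⊥ < N₁ ∧ N₁ < N₂ ∧ N₂ < ⊤))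
    (hred : ∃ N : Subrepresentation ρ, N ≠ ⊥ ∧ N ≠ ⊤)
    {K : Subgroup G} (hKc : IsCompact (K : Set G)) [FiniteDimensional ℂ (ρ.fixedPoints K)]
    (hK : Module.finrank ℂ (ρ.fixedPoints K) = 0)
    {r : SmoothIrrep G} (hr : (IrrClass.mk r).IsConstituentOf ρ) : Module.finrank ℂ (r.ρ.fixedPoints K) = 0 := by
  obtain ⟨N, hb, ht⟩ := hred
  have hN := isIrreducible_toRepresentation_of_forall_not_lt_lt hlen hb ht
  have hQ := isIrreducible_quotientRep_of_forall_not_lt_lt hlen hb ht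
  have hA := Representation.finrank_fixedPoints_eq_add_of_subrepresentation ρ hρ N hKc
  rw [hK] at hA
  have hN0 : Module.finrank ℂ (N.toRepresentation.fixedPoints K) = 0 := by omega
  have hQ0 : Module.finrank ℂ (N.quotientRep.fixedPoints K) = 0 := by omega
  rcases (isConstituentOf_iff_of_isIrreducible hρ N hN hQ _).1 hr with h | h
  · rw [finrank_fixedPoints_eq_of_mk_eq_mk h K]
    exact hQ0
  · rw [finrank_fixedPoints_eq_of_mk_eq_mk h K]
    exact hN0

/-- **`ep r = 0` FOR EVERY CONSTITUENT `r` OF A REDUCIBLE `ρ` WITH LEVELS `(1,1,2)` AND NO TRIVIAL-ACTION CONSTITUENT** — the label-free form of §3: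
`ρ` smooth without `3`-chains, some `⊥ ≠ N ≠ ⊤`, every constituent moved by `G` (`hnt`), `K₀`, `K₁`, `K₀ ⊓ K₁` compact, `K₀ ⊔ K₁ = ⊤`,
`dim ρ^{K₀} = dim ρ^{K₁} = 1`, `dim ρ^{K₀ ⊓ K₁} = 2`.  §2's dichotomy at `N`: its two «`G`-fixed vector» branches would make `ρ|_N` or `ρ⁄N` — both
irreducible constituents (★ `isConstituentOf_iff_of_isIrreducible`) — a trivial-action class (§1 `fixedPoints_top_ne_bot_iff_forall`), excluded by
`hnt`; the surviving branch is transported to `r ∈ {⟦ρ⁄N⟧, ⟦ρ|_N⟧}` by ★ class invariance of the levels.  Covers the `{π²(ξ), πⁿ(ξ)}` AND the l.d.s.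
pairs of [Rogawski1990, §12.2 (2), (3)] uniformly. [cite: Kottwitz1988, §2] [cite: Borel1976, §3–§4] [cite: Rogawski1990, §12.2 pp. 173–174]
[cite: BernsteinZelevinsky1976, §2.3] -/
theorem ep_eq_zero_of_isConstituentOf_of_reducible {V : Type} [AddCommGroup V] [Module ℂ V] {ρ : Representation ℂ G V}
    (hρ : ρ.IsSmooth) (hlen : ∀ N₁ N₂ : Subrepresentation ρ, ¬ (⊥ < N₁ ∧ N₁ < N₂ ∧ N₂ < ⊤))
    (hnt : ∀ r : SmoothIrrep G, (IrrClass.mk r).IsConstituentOf ρ → ∃ (g : G) (v : r.V), r.ρ g v ≠ v)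
    (hred : ∃ N : Subrepresentation ρ, N ≠ ⊥ ∧ N ≠ ⊤)
    {K₀ K₁ : Subgroup G} (hK₀c : IsCompact (K₀ : Set G)) (hK₁c : IsCompact (K₁ : Set G))
    (hIc : IsCompact ((K₀ ⊓ K₁ : Subgroup G) : Set G)) (hgen : K₀ ⊔ K₁ = ⊤)
    (h₀ : Module.finrank ℂ (ρ.fixedPoints K₀) = 1) (h₁ : Module.finrank ℂ (ρ.fixedPoints K₁) = 1)
    (hI : Module.finrank ℂ (ρ.fixedPoints (K₀ ⊓ K₁)) = 2)
    {r : SmoothIrrep G} (hr : (IrrClass.mk r).IsConstituentOf ρ) :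
    (Module.finrank ℂ (r.ρ.fixedPoints K₀) : ℤ) + Module.finrank ℂ (r.ρ.fixedPoints K₁) - Module.finrank ℂ (r.ρ.fixedPoints (K₀ ⊓ K₁)) = 0 := by
  obtain ⟨N, hb, ht⟩ := hred
  have hN := isIrreducible_toRepresentation_of_forall_not_lt_lt hlen hb ht
  have hQ := isIrreducible_quotientRep_of_forall_not_lt_lt hlen hb ht
  have hdich := ep_dichotomy_of_subrepresentation hρ N hK₀c hK₁c hIc hgen h₀ h₁ hI
  -- the two pieces are constituents, hence moved by `G`: no non-zero `G`-fixed vector (§1's irreducible criterion)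
  have hNbot : N.toRepresentation.fixedPoints (⊤ : Subgroup G) = ⊥ := by
    by_contra h
    haveI := hN
    obtain ⟨g, v, hgv⟩ := hnt (SmoothIrrep.mk ↥N.toSubmodule N.toRepresentation hN (hρ.toRepresentation N))
      ((isConstituentOf_iff_of_isIrreducible hρ N hN hQ _).2 (Or.inr rfl))
    exact hgv ((fixedPoints_top_ne_bot_iff_forall N.toRepresentation).1 h g v)
  have hQbot : N.quotientRep.fixedPoints (⊤ : Subgroup G) = ⊥ := by
    by_contra h
    haveI := hQ
    obtain ⟨g, v, hgv⟩ := hnt (SmoothIrrep.mk (V ⧸ N.toSubmodule) N.quotientRep hQ (hρ.quotientRep N))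
      ((isConstituentOf_iff_of_isIrreducible hρ N hN hQ _).2 (Or.inl rfl))
    exact hgv ((fixedPoints_top_ne_bot_iff_forall N.quotientRep).1 h g v)
  rcases hdich with ⟨hN0, hQ0⟩ | h | h
  · rcases (isConstituentOf_iff_of_isIrreducible hρ N hN hQ _).1 hr with e | e
    · rw [finrank_fixedPoints_eq_of_mk_eq_mk e K₀, finrank_fixedPoints_eq_of_mk_eq_mk e K₁, finrank_fixedPoints_eq_of_mk_eq_mk e (K₀ ⊓ K₁)]
      exact hQ0
    · rw [finrank_fixedPoints_eq_of_mk_eq_mk e K₀, finrank_fixedPoints_eq_of_mk_eq_mk e K₁, finrank_fixedPoints_eq_of_mk_eq_mk e (K₀ ⊓ K₁)]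
      exact hN0
  · exact absurd hNbot h
  · exact absurd hQbot h

end IrrClass

end Literature.NumberTheory.Automorphic

end
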